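import Summits.Ventures.PercRepro.Night2NearFatNineLine
import Summits.Ventures.PercRepro.Night2NearFatSixteen

/-!
# night-2: h21's CELL `(2, 1)` AT `|G| = 16` — CLOSED IN THE NON-FAT CASE (gen 40)

A lossy basis pair with a basis line of seven points of `W` (`|W| = 10`): the other basis lines have `≤ 3` points, the only
long class is the line itself, no six-point line exists, and the faces at the line's two basis points hold `≤ 3` points
— the per-face family closes it (`basis_pair_fair_ten_nine_line`, cell `27503/25740`).  With a nine-point line of `V` every
lossy basis pair either has two basis points on it (the pair above) or at most one (`basis_pair_fair_ten_any`: the other basis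
lines share `≤ 1` point with it, `≤ 5` points of `W`; the classes `≤ 8`); with no nine-point line, `localShadowHall_sixteen_of_lines`.
**`localShadowHall_sixteen`**: no fat closure ⇒ the local Hall inequality at `|G| = 16`.  Paper: proofs/NIGHT-2-g40.md §10.
-/

namespace PercRepro.Shadow

open PercRepro.ThmH PercRepro.PerFlat

variable {α : Type*} [DecidableEq α] {M : Matroid α} [M.Finite] {G : Finset α}

/-- **A lossy basis pair with a seven-point basis line at `|W| = 10` is fair.** -/
theorem basis_pair_fair_ten_nine_line (hG : G ∈ flatsQ M (5 + 1)) (hd : (gr M \ G).card = 2)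
    (hk : kColoops M G = 1) (hs : ∀ e ∈ gr M, ∀ f ∈ gr M, e ≠ f → rkN M {e, f} = 2)
    (hl : ∀ e ∈ gr M, M.Indep {e}) (hnf : fatClosures M 5 G 2 = ∅)
    {B : Finset α} (hB : B ∈ thinMembers M 5 G) (hnP : ¬ bigP M G B) {z : α} (hz : z ∈ G \ clF M B)
    (hl0 : loss M 5 G B z ≠ 0) (hW : (G \ insert z B).card = 10) {a b : α}
    (ha : a ∈ insert z B \ coloops M G) (hb : b ∈ insert z B \ coloops M G) (hab : a ≠ b)
    (h7 : ((G \ insert z B) ∩ clF M {a, b}).card = 7) :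
    loss M 5 G B z ≤ rhoL M 5 G B z * lossIncomeH M 5 G (bigP M G) (dshGT2 M 5 G) B z := by
  obtain ⟨ℓ₁, ℓ₂, C₁, C₂, hℓ₁, hℓ₂, hB2, hB1, ho₁, ho₂, hℓℓ, hc₁, hc₂, hcc, hℓc⟩ :=
    ntp_structure hG hd hk hs hl hB hnP hz (s := 6) (by norm_num) (by omega) (by omega)
  have hGg : G ⊆ gr M := (mem_flatsQ.1 hG).1
  have hQG : insert z B ⊆ G := Finset.insert_subset (Finset.mem_sdiff.1 hz).1 (subset_G_of_mem_thinMembers hB)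
  have hQ'g : insert z B \ coloops M G ⊆ gr M := Finset.sdiff_subset.trans (hQG.trans hGg)
  have hind : M.Indep ((insert z B \ coloops M G : Finset α) : Set α) :=
    (indep_insert_of_basis_pair hG hd hk hB hnP hz).subset (by exact_mod_cast (Finset.sdiff_subset))
  have hWg : G \ insert z B ⊆ gr M := Finset.sdiff_subset.trans hGg
  obtain ⟨L, hLdef⟩ : ∃ L : Finset α, L = (G \ insert z B) ∩ clF M {a, b} := ⟨_, rfl⟩
  have hL7 : L.card = 7 := by rw [hLdef]; exact h7
  have hLW : L ⊆ G \ insert z B := by rw [hLdef]; exact Finset.inter_subset_left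
  have hLne : L.Nonempty := by
    rw [← Finset.card_pos, hL7]
    norm_num
  -- a basis line's `W`-part meeting `L` is `L`
  have hLeq : ∀ a' ∈ insert z B \ coloops M G, ∀ b' ∈ insert z B \ coloops M G, a' ≠ b' →
      ∀ w ∈ (G \ insert z B) ∩ clF M {a', b'}, w ∈ L → (G \ insert z B) ∩ clF M {a', b'} = L := by
    intro a' ha' b' hb' hab' w hw hwL
    rw [hLdef] at hwL ⊢
    have hwQ : w ∉ insert z B \ coloops M G := fun h =>
      (Finset.mem_sdiff.1 (Finset.mem_inter.1 hw).1).2 (Finset.mem_sdiff.1 h).1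
    rw [clF_pair_eq_of_mem_of_mem hs hl hQ'g hind ha' hb' ha hb hab' hab (hWg (Finset.mem_inter.1 hw).1) hwQ
      (Finset.mem_inter.1 hw).2 (Finset.mem_inter.1 hwL).2]
  -- `L` is `ℓ₁` or `ℓ₂`
  have hLcov : L = ℓ₁ ∨ L = ℓ₂ := by
    have hB2' := hB2 a ha b hb hab
    rw [← hLdef] at hB2'
    obtain ⟨w, hw⟩ := hLne
    rcases hB2' with h | h | h
    · left
      rcases ho₁ with rfl | ⟨-, a', ha', b', hb', hab', rfl⟩
      · exfalso
        exact Finset.notMem_empty w (h hw)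
      · exact (hLeq a' ha' b' hb' hab' w (h hw) hw).symm
    · right
      rcases ho₂ with rfl | ⟨-, a', ha', b', hb', hab', rfl⟩
      · exfalso
        exact Finset.notMem_empty w (h hw)
      · exact (hLeq a' ha' b' hb' hab' w (h hw) hw).symm
    · exfalso
      omega
  -- a long basis line disjoint from `L` cannot exist (`7 + 5 > 10`)
  have hother : ∀ ℓ' : Finset α, ℓ' ⊆ G \ insert z B →
      (ℓ' = ∅ ∨ (5 ≤ ℓ'.card ∧ ∃ a' ∈ insert z B \ coloops M G, ∃ b' ∈ insert z B \ coloops M G, a' ≠ b' ∧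
        ℓ' = (G \ insert z B) ∩ clF M {a', b'})) → (L ∩ ℓ').card = 0 → ℓ'.card = 0 := by
    intro ℓ' hℓ'W ho hint
    rcases ho with rfl | ⟨h5, -⟩
    · exact Finset.card_empty
    · exfalso
      have hA := Finset.card_union_add_card_inter L ℓ'
      have hU := Finset.card_le_card (Finset.union_subset hLW hℓ'W)
      omega
  -- the classes: a long class is `L` or empty (`7 + 6 − 1 > 10`)
  have hclass : ∀ C : Finset α, (C = C₁ ∨ C = C₂) →
      (C = ∅ ∨ (6 ≤ C.card ∧ ∃ a' ∈ insert z B \ coloops M G, ∃ y ∈ G \ insert z B,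
        C = (G \ insert z B) ∩ clF M {a', y})) → C ⊆ G \ insert z B → C = L ∨ C.card = 0 := by
    intro C hC ho hCW
    rcases ho with rfl | ⟨h6, -⟩
    · exact Or.inr Finset.card_empty
    · rcases hℓc L C hLcov hC with heq | hint
      · exact Or.inl heq.symm
      · exfalso
        have hA := Finset.card_union_add_card_inter L C
        have hU := Finset.card_le_card (Finset.union_subset hLW hCW)
        omega
  have hCW₁ : C₁ ⊆ G \ insert z B := by
    rcases hc₁ with rfl | ⟨-, a', -, y, -, rfl⟩
    · exact Finset.empty_subset _
    · exact Finset.inter_subset_left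
  have hCW₂ : C₂ ⊆ G \ insert z B := by
    rcases hc₂ with rfl | ⟨-, a', -, y, -, rfl⟩
    · exact Finset.empty_subset _
    · exact Finset.inter_subset_left
  have hC₁ := hclass C₁ (Or.inl rfl) hc₁ hCW₁
  have hC₂ := hclass C₂ (Or.inr rfl) hc₂ hCW₂
  -- the per-face bounds at `a` and `b`
  have hfa : ((G \ insert z B) ∩ clF M ((insert z B).erase a)).card ≤ 3 := by
    have := card_inter_face_le_of_line hG hd hk hs hB hnP hz ha hb hab
    omega
  have hfb : ((G \ insert z B) ∩ clF M ((insert z B).erase b)).card ≤ 3 := by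
    have := card_inter_face_le_of_line hG hd hk hs hB hnP hz hb ha (Ne.symm hab)
    have hpair : clF M {b, a} = clF M {a, b} := by rw [Finset.pair_comm]
    rw [hpair] at this
    omega
  -- no six-point line next to the nine-point line
  have hV15 : (G \ coloops M G).card = 15 := by
    rw [card_sdiff_coloops_eq_sub_one hk]
    have := card_sdiff_insert_eq_card_sub_six hG hd hk hB hnP hz
    have hQ6 : 6 ≤ G.card := by
      have h5 := (rkN_insert_sdiff_coloops_eq_five hG hd hk hB hnP hz).2
      have hKQ : coloops M G ⊆ insert z B :=
        fun x hx => Finset.mem_insert_of_mem (coloops_subset_of_mem_thinMembers hG (by omega) hB hx)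
      have := Finset.card_sdiff_of_subset hKQ
      have := Finset.card_le_card hQG
      omega
    omega
  have haV : a ∈ G \ coloops M G := Finset.mem_sdiff.2 ⟨hQG (Finset.mem_sdiff.1 ha).1, (Finset.mem_sdiff.1 ha).2⟩
  have hbV : b ∈ G \ coloops M G := Finset.mem_sdiff.2 ⟨hQG (Finset.mem_sdiff.1 hb).1, (Finset.mem_sdiff.1 hb).2⟩
  have h9 : 7 ≤ ((G \ coloops M G) ∩ clF M {a, b}).card := by
    have := card_inter_W_add_two_le hG hd hB hz ha hb hab
    omega
  have hnosix := no_six_line_of_long_line hG hd hk hs hl hnf hV15 haV hbV hab h9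
  have hdl : ∀ Y ⊆ G \ insert z B, 6 ≤ Y.card →
      ¬ ((∃ a ∈ insert z B \ coloops M G, ∃ b ∈ insert z B \ coloops M G, a ≠ b ∧
          Y.card ≤ (Y ∩ clF M {a, b}).card + 1) ∨
        ∃ a ∈ insert z B \ coloops M G, ∃ y ∈ Y, Y ⊆ clF M {a, y}) →
      dload M 5 G (bigP M G) (dshGT2 M 5 G) (insert z B ∪ Y) = 0 := by
    intro Y hYW hYs hnS
    apply dload_eq_zero_of_shape_of_no_six hG hd hk hs hl hnf hnosix hB hnP hz hYW (by omega)
    · intro a' ha' b' hb' hab'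
      by_contra hlt
      exact hnS (Or.inl ⟨a', ha', b', hb', hab', by omega⟩)
    · intro a' ha' y hy hsub
      exact hnS (Or.inr ⟨a', ha', y, hy, hsub⟩)
  -- one class `L` covers the classes
  have hB1'' : ∀ a' ∈ insert z B \ coloops M G, ∀ y ∈ G \ insert z B,
      (G \ insert z B) ∩ clF M {a', y} ⊆ L ∨ (G \ insert z B) ∩ clF M {a', y} ⊆ (∅ : Finset α) ∨
        ((G \ insert z B) ∩ clF M {a', y}).card + 1 ≤ 6 := by
    intro a' ha' y hy
    rcases hB1 a' ha' y hy with h | h | h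
    · rcases hC₁ with rfl | h0
      · exact Or.inl h
      · rw [Finset.card_eq_zero] at h0
        rw [h0] at h
        exact Or.inr (Or.inl h)
    · rcases hC₂ with rfl | h0
      · exact Or.inl h
      · rw [Finset.card_eq_zero] at h0
        rw [h0] at h
        exact Or.inr (Or.inl h)
    · exact Or.inr (Or.inr h)
  -- the basis lines: `(L, ∅)` after the case analysis
  have hB2L : ∀ a' ∈ insert z B \ coloops M G, ∀ b' ∈ insert z B \ coloops M G, a' ≠ b' →
      (G \ insert z B) ∩ clF M {a', b'} ⊆ L ∨ (G \ insert z B) ∩ clF M {a', b'} ⊆ (∅ : Finset α) ∨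
        ((G \ insert z B) ∩ clF M {a', b'}).card + 2 ≤ 6 := by
    intro a' ha' b' hb' hab'
    rcases hB2 a' ha' b' hb' hab' with h | h | h
    · -- inside `ℓ₁`
      rcases hLcov with hL₁ | hL₂
      · exact Or.inl (hL₁ ▸ h)
      · rcases hℓℓ with heq | hint
        · exact Or.inl (by rw [hL₂, ← heq]; exact h)
        · have h0 : ℓ₁.card = 0 := hother ℓ₁ hℓ₁ ho₁ (by rw [hL₂, Finset.inter_comm]; exact hint)
          rw [Finset.card_eq_zero] at h0
          rw [h0] at h
          exact Or.inr (Or.inl h)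
    · rcases hLcov with hL₁ | hL₂
      · rcases hℓℓ with heq | hint
        · exact Or.inl (by rw [hL₁, heq]; exact h)
        · have h0 : ℓ₂.card = 0 := hother ℓ₂ hℓ₂ ho₂ (by rw [hL₁]; exact hint)
          rw [Finset.card_eq_zero] at h0
          rw [h0] at h
          exact Or.inr (Or.inl h)
      · exact Or.inl (hL₂ ▸ h)
    · exact Or.inr (Or.inr h)
  apply basis_pair_fair_of_ntpB hG hd hk hs hl hnf hB hnP hz hl0 (by norm_num : 1 ≤ 6) ha hb hab hfa hfb hdl hLW
    (Finset.empty_subset _) hB2L (C₁ := L) (C₂ := ∅) hB1''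
  rw [hW, hL7, Finset.card_empty]
  exact one_le_ntpIncomeB_ten_seven

/-- Two points of `V` on a line of `V` span it. -/
theorem clF_pair_eq_of_two_mem_line (hs : ∀ e ∈ gr M, ∀ f ∈ gr M, e ≠ f → rkN M {e, f} = 2)
    {u v p q : α} (hu : u ∈ gr M) (hv : v ∈ gr M) (hp : p ∈ gr M) (hq : q ∈ gr M) (huv : u ≠ v) (hpq : p ≠ q)
    (hpl : p ∈ clF M {u, v}) (hql : q ∈ clF M {u, v}) : clF M {p, q} = clF M {u, v} :=
  clF_pair_eq_of_subset_clF_pair hs hu hv hp hq huv hpq hpl hql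

/-- **h21's cell `(2, 1)` at `|G| = 16`**: no fat closure ⇒ the local Hall inequality. -/
theorem localShadowHall_sixteen (hG : G ∈ flatsQ M (5 + 1)) (hd : (gr M \ G).card = 2)
    (hk : kColoops M G = 1) (hs : ∀ e ∈ gr M, ∀ f ∈ gr M, e ≠ f → rkN M {e, f} = 2)
    (hl : ∀ e ∈ gr M, M.Indep {e}) (hnf : fatClosures M 5 G 2 = ∅) (h16 : G.card = 16) :
    LocalShadowHall M 5 G := by
  by_cases hnine : ∃ u ∈ G \ coloops M G, ∃ v ∈ G \ coloops M G, u ≠ v ∧ ((G \ coloops M G) ∩ clF M {u, v}).card = 9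
  · obtain ⟨u, hu, v, hv, huv, h9⟩ := hnine
    have hGg : G ⊆ gr M := (mem_flatsQ.1 hG).1
    have hVg : G \ coloops M G ⊆ gr M := Finset.sdiff_subset.trans hGg
    have hV15 : (G \ coloops M G).card = 15 := by
      rw [card_sdiff_coloops_eq_sub_one hk, h16]
    have hfat : (fatClosures M 5 G 2).card ≤ 1 := by
      rw [hnf, Finset.card_empty]
      exact zero_le_one
    -- a line of `V` other than the nine-point line holds at most seven points of `V`
    have hshort : ∀ p ∈ G \ coloops M G, ∀ q ∈ G \ coloops M G, p ≠ q → clF M {p, q} ≠ clF M {u, v} →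
        ((G \ coloops M G) ∩ clF M {p, q}).card ≤ 7 := by
      intro p hp q hq hpq hne
      have hshare : (((G \ coloops M G) ∩ clF M {p, q}) ∩ ((G \ coloops M G) ∩ clF M {u, v})).card ≤ 1 := by
        by_contra hlt
        push Not at hlt
        obtain ⟨w, hw, w', hw', hww'⟩ := Finset.one_lt_card.1 hlt
        simp only [Finset.mem_inter] at hw hw'
        apply hne
        rw [← clF_pair_eq_of_two_mem_line hs (hVg hp) (hVg hq) (hVg hw.1.1) (hVg hw'.1.1) hpq hww' hw.1.2 hw'.1.2,
          ← clF_pair_eq_of_two_mem_line hs (hVg hu) (hVg hv) (hVg hw.1.1) (hVg hw'.1.1) huv hww' hw.2.2 hw'.2.2]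
      have hsplit := Finset.card_sdiff_add_card_inter ((G \ coloops M G) ∩ clF M {p, q}) ((G \ coloops M G) ∩ clF M {u, v})
      have hsub : ((G \ coloops M G) ∩ clF M {p, q}) \ ((G \ coloops M G) ∩ clF M {u, v}) ⊆
          (G \ coloops M G) \ ((G \ coloops M G) ∩ clF M {u, v}) := by
        intro w hw
        rw [Finset.mem_sdiff] at hw ⊢
        exact ⟨(Finset.mem_inter.1 hw.1).1, hw.2⟩
      have h1 := Finset.card_le_card hsub
      rw [Finset.card_sdiff_of_subset Finset.inter_subset_left, hV15, h9] at h1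
      omega
    apply localShadowHall_of_gt2_of_basis_fair hG hd hk hs hl hfat
    intro B hB hnP z hz
    by_cases hl0 : loss M 5 G B z = 0
    · rw [hl0]
      have hd' : (gr M \ G).card ≤ 5 := by omega
      have h1 : 0 ≤ rhoL M 5 G B z := by
        unfold rhoL
        rw [hl0]
        simp
      have h2 : 0 ≤ lossIncomeH M 5 G (bigP M G) (dshGT2 M 5 G) B z :=
        lossIncomeH_nonneg hG hd' (column_side_gt2 hG hd hk hs hl hfat) B z
      positivity
    · have hQG : insert z B ⊆ G := Finset.insert_subset (Finset.mem_sdiff.1 hz).1 (subset_G_of_mem_thinMembers hB)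
      have hW := card_sdiff_insert_eq_card_sub_six hG hd hk hB hnP hz
      have hQ'V : ∀ a ∈ insert z B \ coloops M G, a ∈ G \ coloops M G := fun a ha =>
        Finset.mem_sdiff.2 ⟨hQG (Finset.mem_sdiff.1 ha).1, (Finset.mem_sdiff.1 ha).2⟩
      have hWV : ∀ y ∈ G \ insert z B, y ∈ G \ coloops M G := fun y hy =>
        Finset.mem_sdiff.2 ⟨(Finset.mem_sdiff.1 hy).1, fun hK => (Finset.mem_sdiff.1 hy).2
          (Finset.mem_insert_of_mem (coloops_subset_of_mem_thinMembers hG (by omega) hB hK))⟩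
      -- the basis points on the nine-point line
      by_cases hr : ∃ a ∈ insert z B \ coloops M G, ∃ b ∈ insert z B \ coloops M G, a ≠ b ∧
          a ∈ clF M {u, v} ∧ b ∈ clF M {u, v}
      · obtain ⟨a, ha, b, hb, hab, hal, hbl⟩ := hr
        have hcl : clF M {a, b} = clF M {u, v} :=
          clF_pair_eq_of_two_mem_line hs (hVg hu) (hVg hv) (hVg (hQ'V a ha)) (hVg (hQ'V b hb)) huv hab hal hbl
        apply basis_pair_fair_ten_nine_line hG hd hk hs hl hnf hB hnP hz hl0 (by omega) ha hb hab
        -- `|W ∩ cl {a, b}| = 9 − 2`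
        have h2 := card_inter_W_add_two_le hG hd hB hz ha hb hab
        have hind : M.Indep ((insert z B \ coloops M G : Finset α) : Set α) :=
          (indep_insert_of_basis_pair hG hd hk hB hnP hz).subset (by exact_mod_cast (Finset.sdiff_subset))
        have hQ'l : ((insert z B \ coloops M G) ∩ clF M {a, b}).card ≤ 2 :=
          card_inter_le_two_of_indep_of_rkN_le_two hind (by rw [rkN_clF, hs a (hVg (hQ'V a ha)) b (hVg (hQ'V b hb)) hab])
        -- `V ∩ cl {a, b} ⊆ (W ∩ cl {a, b}) ∪ (Q′ ∩ cl {a, b})`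
        have hsplit : (G \ coloops M G) ∩ clF M {a, b} ⊆
            ((G \ insert z B) ∩ clF M {a, b}) ∪ ((insert z B \ coloops M G) ∩ clF M {a, b}) := by
          intro w hw
          rw [Finset.mem_inter] at hw
          rw [Finset.mem_union, Finset.mem_inter, Finset.mem_inter, Finset.mem_sdiff, Finset.mem_sdiff]
          by_cases hwQ : w ∈ insert z B
          · exact Or.inr ⟨⟨hwQ, (Finset.mem_sdiff.1 hw.1).2⟩, hw.2⟩
          · exact Or.inl ⟨⟨(Finset.mem_sdiff.1 hw.1).1, hwQ⟩, hw.2⟩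
        have h3 := Finset.card_le_card hsplit
        have h4 := Finset.card_union_le ((G \ insert z B) ∩ clF M {a, b}) ((insert z B \ coloops M G) ∩ clF M {a, b})
        have hV9 : ((G \ coloops M G) ∩ clF M {a, b}).card = 9 := by rw [hcl]; exact h9
        omega
      · push Not at hr
        -- at most one basis point on the nine-point line: the other lines are short
        apply basis_pair_fair_ten_any hG hd hk hs hl hnf hB hnP hz hl0 (by omega)
        · intro a ha b hb hab
          have hpair : ({a, b} : Finset α) ⊆ gr M := by
            intro e he
            rw [Finset.mem_insert, Finset.mem_singleton] at he
            rcases he with he | he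
            · rw [he]; exact hVg (hQ'V a ha)
            · rw [he]; exact hVg (hQ'V b hb)
          have hne : clF M {a, b} ≠ clF M {u, v} := by
            intro heq
            have hal : a ∈ clF M {u, v} := heq ▸ subset_clF_of_subset_gr hpair (Finset.mem_insert_self _ _)
            have hbl : b ∈ clF M {u, v} :=
              heq ▸ subset_clF_of_subset_gr hpair (Finset.mem_insert_of_mem (Finset.mem_singleton_self _))
            exact hr a ha b hb hab hal hbl
          have := le_trans (card_inter_W_add_two_le hG hd hB hz ha hb hab) (hshort a (hQ'V a ha) b (hQ'V b hb) hab hne)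
          omega
        · intro a ha y hy
          have hay : a ≠ y := fun h => (Finset.mem_sdiff.1 hy).2 (h ▸ (Finset.mem_sdiff.1 ha).1)
          by_cases heq : clF M {a, y} = clF M {u, v}
          · -- the class is the nine-point line minus its basis points: `≤ 8`
            have h1 := card_inter_W_add_one_le hG hd hB hz ha hy
            rw [heq] at h1 ⊢
            rw [h9] at h1
            omega
          · have := le_trans (card_inter_W_add_one_le hG hd hB hz ha hy) (hshort a (hQ'V a ha) y (hWV y hy) hay heq)
            omega
  · push Not at hnine
    exact localShadowHall_sixteen_of_lines hG hd hk hs hl hnf h16 hnine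

end PercRepro.Shadow
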